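import Mathlib
import Literature.Analysis.FunctionSpaces.TorusFluidGlue
import Literature.Analysis.FluidPDE.TorusClassicalNSContinuation
import Literature.Analysis.FluidPDE.TorusClassicalNSForcedRestart
import Literature.Analysis.FluidPDE.NavierStokesConcentrationTools
import HarnessLib

/-!
# Route `ForcedAmplifier`, aside `BlowupAlternative` (item stmt-NavierStokesRegularity-28106) — tools I:
# the PDE core of the forced `H¹` blow-up alternative on `𝕋³`

`amplification_of_noncontinuable`: fix `ν > 0`, a horizon `T > 0`, a smooth divergence-free MEAN-ZERO datum
`u₀` and a force presented as `f = ∂ₜū` (one-sided derivative within `[0, ∞)`) of a field `ū` jointly smooth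
on `[0,∞) × 𝕋³` with divergence-free mean-zero slices.  If NO classical solution of NS_ν(f) on `[0,T] × 𝕋³`
starts at `u₀`, then smooth forced episodes of one data size `A` and horizon `T₀ = T` reach arbitrarily
large `‖u(t)‖²_{H¹}` — the `ν`-slice of the route's residual `AMP`.

Proof (maximal-solution argument, Constantin–Foias 1988 Ch. 10 / Robinson–Rodrigo–Sadowski 2016 §8.1, run
on the tree's local theory): with `A := max ‖u₀‖²_{H¹} (sup_{[0,T+1]} ‖f(t)‖²_{H¹})`, suppose `M` bounds
`‖u(t)‖²_{H¹}` along every episode of these sizes.  Let `𝒮` be the set of horizons `b ∈ (0,T]` reached by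
a classical solution from `u₀`; it is non-empty (`Torus.exists_classicalNS_forced_local`), downward closed,
and `T ∉ 𝒮`; put `T* := sup 𝒮`.  A BACKGROUND solution `W` of NS_ν(f) from the ZERO datum lives on a window
`[t₀, e] ∋ T*` (uniform restart theorem `Torus.exists_classicalNS_forced_restart`, decay level `0`); it has
mean-zero slices and an `H⁴` bound `D`.  Every solution from `u₀` on `[0,b]`, `b ∈ 𝒮`, has mean-zero
slices (mean-zero force), enstrophy `≤ M`, hence by the tree's parabolic smoothing chain
(`…integral_norm_laplacian_laplacian_sq_le_of_gradNormSq_le`, lapse `τ = T*/8`) an `H⁴` bound `C` on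
`[3τ, b]` UNIFORM IN `b`.  The perturbative local theory around `W` (`Torus.perturbedNS_exists_local_of_le`,
level `2C + 2D`) has a lifespan `θ > 0`; restart at `s₀ := max(3τ, t₀, T* − θ/2) < T*` from a solution
reaching `b := (s₀ + T*)/2 ∈ 𝒮`, add the background (`add_perturbation`) and glue (`glue_restart`): a
classical solution from `u₀` on `[0, s₀ + θ]`, `s₀ + θ > T*` — contradicting `sup 𝒮 = T*` or `T ∉ 𝒮`.

Definition-free; no `sorry`; axioms ⊆ {propext, Classical.choice, Quot.sound}.
Sources: [ConstantinFoias1988] Ch. 10 pp. 54–55; [Tao2013Localisation] arXiv:1108.1165 Thm 5.1, Lemma 5.2, Conj. 1.10;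
[RobinsonRodrigoSadowskiCUP2016] §6.8/§8.1.  Lens provenance: decomp-ns lens 4, generation 26
(HOME/decomp-ns-lens-4/NODE-g26.md, ForcedAmplifierAlternative.lean).
-/

set_option linter.dupNamespace false

noncomputable section

open Set Function Filter MeasureTheory
open scoped ContDiff Topology Pointwise

namespace Summit.NavierStokesRegularity.NavierStokesRegularity.Theorems.ForcedAmplifierBlowupAlternativeCore

open Literature.Analysis.FunctionSpaces
open Literature.Analysis.FluidPDE

/-! Throughout, `𝕋³ = UnitAddTorus (Fin 3)`, `ℝ³ = EuclideanSpace ℝ (Fin 3)`, and the squared `H¹(𝕋³)` size of a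
slice `v` is written out as `2 * Torus.kineticEnergy v + Torus.gradNormSq v` (`= ‖v‖²_{L²} + ‖∇v‖²_{L²}`,
[Tao2013Localisation] §1 eq. (5)); the file is definition-free. -/

/-! ## Elementary size lemmas -/

/-- The enstrophy part is dominated by the full `H¹` size. -/
theorem gradNormSq_le_h1Sq (v : UnitAddTorus (Fin 3) → EuclideanSpace ℝ (Fin 3)) :
    Torus.gradNormSq v ≤ 2 * Torus.kineticEnergy v + Torus.gradNormSq v := by
  linarith [Torus.kineticEnergy_nonneg v]

section Sizes

variable {S K : Set ℝ} {w : ℝ → UnitAddTorus (Fin 3) → EuclideanSpace ℝ (Fin 3)}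

/-- `∫ ‖w(t)‖² ≤ C` on a compact time set (joint smoothness ⟹ boundedness; `vol 𝕋³ = 1`). [folklore] -/
theorem exists_integral_norm_sq_le (hw : Torus.IsSmoothSpaceTimeOn S w) (hK : IsCompact K) (hKS : K ⊆ S) :
    ∃ C : ℝ, ∀ t ∈ K, ∫ x, ‖w t x‖ ^ 2 ≤ C := by
  obtain ⟨c, hc⟩ := hw.exists_norm_le_of_isCompact hK hKS
  refine ⟨c ^ 2, fun t ht => ?_⟩
  have hpt : ∀ x, ‖w t x‖ ^ 2 ≤ c ^ 2 := fun x => pow_le_pow_left₀ (norm_nonneg _) (hc t ht x) 2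
  calc ∫ x, ‖w t x‖ ^ 2 ≤ ∫ _ : UnitAddTorus (Fin 3), c ^ 2 :=
        integral_mono (hw.isSmooth_slice (hKS ht)).norm_sq.integrable (integrable_const _) hpt
    _ = c ^ 2 := by simp

/-- `gradNormSq (w t) ≤ G` on a compact time set. [folklore] -/
theorem exists_gradNormSq_le (hw : Torus.IsSmoothSpaceTimeOn S w) (hU : UniqueDiffOn ℝ S)
    (hK : IsCompact K) (hKS : K ⊆ S) : ∃ G : ℝ, ∀ t ∈ K, Torus.gradNormSq (w t) ≤ G := by
  have h : ∀ i : Fin 3, ∃ c : ℝ, ∀ t ∈ K, ∀ x, ‖Torus.partialDeriv i (w t) x‖ ≤ c := fun i =>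
    (hw.partialDeriv hU i).exists_norm_le_of_isCompact hK hKS
  choose c hc using h
  refine ⟨∑ i, c i ^ 2, fun t ht => ?_⟩
  have hint : ∀ i : Fin 3, Integrable (fun x => ‖Torus.partialDeriv i (w t) x‖ ^ 2) volume := fun i =>
    (((hw.partialDeriv hU i).isSmooth_slice (hKS ht)).norm_sq).integrable
  unfold Torus.gradNormSq
  calc ∫ x, ∑ i, ‖Torus.partialDeriv i (w t) x‖ ^ 2 ≤ ∫ _ : UnitAddTorus (Fin 3), ∑ i, c i ^ 2 :=
        integral_mono (integrable_finsetSum _ fun i _ => hint i) (integrable_const _) fun x =>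
          Finset.sum_le_sum fun i _ => pow_le_pow_left₀ (norm_nonneg _) (hc i t ht x) 2
    _ = ∑ i, c i ^ 2 := by simp

/-- `‖w(t)‖²_{H¹} ≤ A` on a compact time set. [folklore] -/
theorem exists_h1Sq_le (hw : Torus.IsSmoothSpaceTimeOn S w) (hU : UniqueDiffOn ℝ S)
    (hK : IsCompact K) (hKS : K ⊆ S) :
    ∃ A : ℝ, ∀ t ∈ K, 2 * Torus.kineticEnergy (w t) + Torus.gradNormSq (w t) ≤ A := by
  obtain ⟨C, hC⟩ := exists_integral_norm_sq_le hw hK hKS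
  obtain ⟨G, hG⟩ := exists_gradNormSq_le hw hU hK hKS
  refine ⟨C + G, fun t ht => ?_⟩
  have h1 := hC t ht
  have h2 := hG t ht
  simp only [Torus.kineticEnergy]
  linarith

/-- The one-sided time derivative of a field with mean-zero slices has mean-zero slices (differentiate
`t ↦ ∫ w(t) = 0` under the integral, `IsSmoothSpaceTimeOn.hasDerivWithinAt_integral`). [folklore] -/
theorem integral_timeDerivWithin_eq_zero (hw : Torus.IsSmoothSpaceTimeOn S w) (hS : Convex ℝ S)
    (hU : UniqueDiffOn ℝ S) (hmean : ∀ t ∈ S, Torus.HasZeroMean (w t)) {t : ℝ} (ht : t ∈ S) :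
    ∫ x, Torus.timeDerivWithin S w t x = 0 := by
  have h1 := hw.hasDerivWithinAt_integral hS ht
  have h2 : HasDerivWithinAt (fun s => ∫ x, w s x) (0 : EuclideanSpace ℝ (Fin 3)) S t :=
    (hasDerivWithinAt_const (x := t) (s := S) (c := (0 : EuclideanSpace ℝ (Fin 3)))).congr_of_mem (fun y hy => hmean y hy) ht
  exact (hU t ht).eq_deriv _ h1 h2

end Sizes

/-! ## The core: non-continuability forces amplification -/

/-- **The forced `H¹` blow-up alternative, normalised class** (Constantin–Foias 1988, Ch. 10; Robinson–
Rodrigo–Sadowski 2016, §8.1, with the tree's local/perturbative/smoothing theory): if no classical solution of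
NS_ν(∂ₜū) on `[0,T] × 𝕋³` starts at the mean-zero datum `u₀`, then smooth forced episodes at viscosity `ν` of ONE data size and
horizon reach arbitrarily large `H¹` norm (the `ν`-slice of the route's `AMP`). See the module docstring for
the proof. [cite: ConstantinFoias1988, Ch. 10 pp. 54–55; Tao2013Localisation, Thm 5.1 + Lemma 5.2] -/
theorem amplification_of_noncontinuable {ν T : ℝ} (hν : 0 < ν) (hT : 0 < T)
    {u₀ : UnitAddTorus (Fin 3) → EuclideanSpace ℝ (Fin 3)} (hu₀ : Torus.IsSmooth u₀) (hu₀div : Torus.IsDivFree u₀) (hu₀mean : Torus.HasZeroMean u₀)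
    {ū : ℝ → UnitAddTorus (Fin 3) → EuclideanSpace ℝ (Fin 3)} (hū : Torus.IsSmoothSpaceTimeOn (Ici 0) ū)
    (hūdiv : ∀ t ∈ Ici (0 : ℝ), Torus.IsDivFree (ū t)) (hūmean : ∀ t ∈ Ici (0 : ℝ), Torus.HasZeroMean (ū t))
    (hno : ∀ (u : ℝ → UnitAddTorus (Fin 3) → EuclideanSpace ℝ (Fin 3)) (p : ℝ → UnitAddTorus (Fin 3) → ℝ),
      ¬ (Torus.IsClassicalNSSolutionOn (Icc 0 T) ν (fun t x => Torus.timeDerivWithin (Ici 0) ū t x) u p ∧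
          u 0 = u₀)) :
    ∃ A T₀ : ℝ, ∀ M : ℝ, ∃ (T' : ℝ) (f' u : ℝ → UnitAddTorus (Fin 3) → EuclideanSpace ℝ (Fin 3)) (p : ℝ → UnitAddTorus (Fin 3) → ℝ),
      (0 < T' ∧ Torus.IsClassicalNSSolutionOn (Icc 0 T') ν f' u p ∧ Torus.IsSmoothSpaceTimeOn (Icc 0 T') f') ∧
        T' ≤ T₀ ∧ 2 * Torus.kineticEnergy (u 0) + Torus.gradNormSq (u 0) ≤ A ∧
          (∀ t ∈ Icc 0 T', 2 * Torus.kineticEnergy (f' t) + Torus.gradNormSq (f' t) ≤ A) ∧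
            ∃ t ∈ Icc 0 T', M < 2 * Torus.kineticEnergy (u t) + Torus.gradNormSq (u t) := by
  -- the force and its basic properties
  have hUi : UniqueDiffOn ℝ (Ici (0 : ℝ)) := uniqueDiffOn_Ici 0
  have hf : Torus.IsSmoothSpaceTimeOn (Ici 0) (fun t x => Torus.timeDerivWithin (Ici 0) ū t x) :=
    hū.timeDerivWithin hUi
  set f : ℝ → UnitAddTorus (Fin 3) → EuclideanSpace ℝ (Fin 3) := fun t x => Torus.timeDerivWithin (Ici 0) ū t x with hfdef
  have hfI : ∀ {a b : ℝ}, 0 ≤ a → a < b →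
      ∀ t ∈ Icc a b, ∀ x, Torus.timeDerivWithin (Icc a b) ū t x = f t x := fun ha hab t ht x =>
    hū.timeDerivWithin_eq_of_subset (fun s hs => mem_Ici.2 (ha.trans hs.1)) (uniqueDiffOn_Icc hab) ht x
  have hfmean : ∀ t ∈ Ici (0 : ℝ), ∫ x, f t x = 0 := fun t ht =>
    integral_timeDerivWithin_eq_zero hū (convex_Ici 0) hUi hūmean ht
  -- force levels on `[0, T + 1]`
  have hK : IsCompact (Icc (0 : ℝ) (T + 1)) := isCompact_Icc
  have hKS : Icc (0 : ℝ) (T + 1) ⊆ Ici 0 := Icc_subset_Ici_self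
  obtain ⟨A₁, hA₁⟩ := exists_h1Sq_le hf hUi hK hKS
  obtain ⟨G, hG⟩ := exists_gradNormSq_le hf hUi hK hKS
  obtain ⟨G₂, hG₂⟩ := exists_integral_norm_sq_le (hf.laplacian hUi) hK hKS
  obtain ⟨G₃, hG₃⟩ := exists_gradNormSq_le (hf.laplacian hUi) hUi hK hKS
  -- suppose, for contradiction, that `M` bounds the episodes of sizes `A := max ‖u₀‖² A₁`, `T₀ := T`
  refine ⟨max (2 * Torus.kineticEnergy u₀ + Torus.gradNormSq u₀) A₁, T, ?_⟩
  by_contra hcon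
  push Not at hcon
  obtain ⟨M, hM⟩ := hcon
  -- enstrophy bound and mean-zero slices for solutions from `u₀`
  have hE : ∀ {b : ℝ} {u : ℝ → UnitAddTorus (Fin 3) → EuclideanSpace ℝ (Fin 3)} {p : ℝ → UnitAddTorus (Fin 3) → ℝ}, 0 < b → b ≤ T →
      Torus.IsClassicalNSSolutionOn (Icc 0 b) ν f u p → u 0 = u₀ →
        ∀ t ∈ Icc 0 b, Torus.gradNormSq (u t) ≤ M := by
    intro b u p hb hbT hsol hu0 t ht
    have hep : 0 < b ∧ Torus.IsClassicalNSSolutionOn (Icc 0 b) ν f u p ∧ Torus.IsSmoothSpaceTimeOn (Icc 0 b) f :=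
      ⟨hb, hsol, hf.mono Icc_subset_Ici_self⟩
    have h1 := hM b f u p hep hbT (by rw [hu0]; exact le_max_left _ _)
      (fun s hs => (hA₁ s ⟨hs.1, hs.2.trans (by linarith)⟩).trans (le_max_right _ _)) t ht
    exact (gradNormSq_le_h1Sq _).trans h1
  have hmz : ∀ {b : ℝ} {u : ℝ → UnitAddTorus (Fin 3) → EuclideanSpace ℝ (Fin 3)} {p : ℝ → UnitAddTorus (Fin 3) → ℝ}, 0 < b →
      Torus.IsClassicalNSSolutionOn (Icc 0 b) ν f u p → u 0 = u₀ →
        ∀ t ∈ Icc 0 b, Torus.HasZeroMean (u t) := by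
    intro b u p hb hsol hu0 t ht
    unfold Torus.HasZeroMean
    rw [hsol.integral_velocity_eq (convex_Icc 0 b) (fun s hs => hfmean s (mem_Ici.2 hs.1))
      (left_mem_Icc.2 hb.le) ht, hu0]
    exact hu₀mean
  -- the set of horizons reached from `u₀`
  set 𝒮 : Set ℝ := {b : ℝ | 0 < b ∧ b ≤ T ∧ ∃ (u : ℝ → UnitAddTorus (Fin 3) → EuclideanSpace ℝ (Fin 3)) (p : ℝ → UnitAddTorus (Fin 3) → ℝ),
      Torus.IsClassicalNSSolutionOn (Icc 0 b) ν f u p ∧ u 0 = u₀} with h𝒮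
  have hbdd : BddAbove 𝒮 := ⟨T, fun b hb => hb.2.1⟩
  have hūT : Torus.IsSmoothSpaceTimeOn (Icc 0 T) ū := hū.mono Icc_subset_Ici_self
  obtain ⟨θ₀, hθ₀, hθ₀T, uθ, pθ, hsolθ, huθ0⟩ := Torus.exists_classicalNS_forced_local hν hT hūT
      (fun t ht => hūdiv t (mem_Ici.2 ht.1)) (hfI le_rfl hT) hu₀ hu₀div
  rw [zero_add] at hθ₀T hsolθ
  have hθ₀mem : θ₀ ∈ 𝒮 := ⟨hθ₀, hθ₀T, uθ, pθ, hsolθ, huθ0⟩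
  have hne : 𝒮.Nonempty := ⟨θ₀, hθ₀mem⟩
  set Ts : ℝ := sSup 𝒮 with hTs
  have hθ₀Ts : θ₀ ≤ Ts := le_csSup hbdd hθ₀mem
  have hTs0 : 0 < Ts := hθ₀.trans_le hθ₀Ts
  have hTsT : Ts ≤ T := csSup_le hne fun b hb => hb.2.1
  have hdown : ∀ {b b' : ℝ}, b ∈ 𝒮 → 0 < b' → b' ≤ b → b' ∈ 𝒮 := by
    rintro b b' ⟨-, hbT, u, p, hsol, hu0⟩ hb' hb'b
    exact ⟨hb', hb'b.trans hbT, u, p, hsol.mono (Icc_subset_Icc le_rfl hb'b) (uniqueDiffOn_Icc hb'), hu0⟩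
  have hbelow : ∀ {b' : ℝ}, 0 < b' → b' < Ts → b' ∈ 𝒮 := by
    intro b' hb' hb'Ts
    obtain ⟨b, hb, hb'b⟩ := exists_lt_of_lt_csSup hne hb'Ts
    exact hdown hb hb' hb'b.le
  have habove : ∀ {c : ℝ}, Ts < c → c ∉ 𝒮 := by
    intro c hc hcmem
    have h : c ≤ Ts := le_csSup hbdd hcmem
    exact absurd hc (not_lt.2 h)
  -- the background `W` from the zero datum on a window around `T*`
  have hT1 : (0 : ℝ) < T + 1 := by linarith
  have hūT1 : Torus.IsSmoothSpaceTimeOn (Icc 0 (T + 1)) ū := hū.mono Icc_subset_Ici_self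
  obtain ⟨θW, hθW, hrestartW⟩ := Torus.exists_classicalNS_forced_restart hν hT1 hūT1
      (fun t ht => hūdiv t (mem_Ici.2 ht.1)) (hfI le_rfl hT1) 0
  set t₀ : ℝ := max 0 (Ts - θW / 2) with ht₀
  have ht₀0 : 0 ≤ t₀ := le_max_left _ _
  have ht₀Ts : t₀ < Ts := max_lt hTs0 (by linarith)
  have ht₀mem : t₀ ∈ Icc 0 (T + 1) := ⟨ht₀0, by linarith⟩
  set θ' : ℝ := min θW (T + 1 - t₀) with hθ'
  have hθ'0 : 0 < θ' := lt_min hθW (by linarith)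
  have hθ'W : θ' ≤ θW := min_le_left _ _
  have ht₀θ' : t₀ + θ' ≤ T + 1 := by
    have := min_le_right θW (T + 1 - t₀)
    linarith
  have hzdiv : Torus.IsDivFree (fun _ : UnitAddTorus (Fin 3) => (0 : EuclideanSpace ℝ (Fin 3))) := by
    intro x
    simp [Torus.divergence, Torus.partialDeriv, Torus.lineDeriv]
  obtain ⟨W, qW, hW, hW0⟩ := hrestartW t₀ ht₀mem θ' hθ'0 hθ'W ht₀θ' (fun _ => 0) (Torus.isSmooth_const _)
    hzdiv (fun j ξ => by simp [UnitAddTorus.mFourierCoeff])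
  set e : ℝ := t₀ + θ' with he
  have hTse : Ts < e := by
    rcases le_total θW (T + 1 - t₀) with h | h
    · have h1 : θ' = θW := min_eq_left h
      have h2 : Ts - θW / 2 ≤ t₀ := le_max_right _ _
      linarith
    · have h1 : θ' = T + 1 - t₀ := min_eq_right h
      linarith
  have ht₀e : t₀ < e := ht₀Ts.trans hTse
  have hWmean : ∀ t ∈ Icc t₀ e, Torus.HasZeroMean (W t) := by
    intro t ht
    unfold Torus.HasZeroMean
    rw [hW.integral_velocity_eq (convex_Icc t₀ e) (fun s hs => hfmean s (mem_Ici.2 (ht₀0.trans hs.1)))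
      (left_mem_Icc.2 ht₀e.le) ht, hW0]
    simp
  obtain ⟨D, hD⟩ := hW.smooth_velocity.exists_integral_norm_laplacian_laplacian_sq_le ht₀e
  -- the uniform `H⁴` bound of solutions from `u₀` at times `≥ 3τ`, `τ = T*/8`
  set τ : ℝ := Ts / 8 with hτ
  have hτ0 : 0 < τ := by positivity
  obtain ⟨C, hC⟩ :=
    Torus.IsClassicalNSSolutionOn.integral_norm_laplacian_laplacian_sq_le_of_gradNormSq_le
      (d := Fin 3) (Fintype.card_fin 3) hν M G G₂ G₃ hτ0
  have hH4 : ∀ {b : ℝ} {u : ℝ → UnitAddTorus (Fin 3) → EuclideanSpace ℝ (Fin 3)} {p : ℝ → UnitAddTorus (Fin 3) → ℝ}, 0 < b → b ≤ T →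
      Torus.IsClassicalNSSolutionOn (Icc 0 b) ν f u p → u 0 = u₀ →
        ∀ s ∈ Icc 0 b, 3 * τ ≤ s → ∫ x, ‖Torus.laplacian (Torus.laplacian (u s)) x‖ ^ 2 ≤ C := by
    intro b u p hb hbT hsol hu0 s hs h3
    have hsub : Icc 0 b ⊆ Icc 0 (T + 1) := Icc_subset_Icc le_rfl (by linarith)
    exact hC hsol (hmz hb hsol hu0) (hE hb hbT hsol hu0) (fun t ht => hG t (hsub ht))
      (fun t ht => hG₂ t (hsub ht)) (fun t ht => hG₃ t (hsub ht)) s hs (by linarith)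
  -- the perturbative lifespan around `W`, capped by `e − T*`
  obtain ⟨θp, hθp, hθpcap, hrestartP⟩ := Torus.perturbedNS_exists_local_of_le (d := Fin 3)
      (Fintype.card_fin 3).le hν ht₀e hW.smooth_velocity hW.divFree (2 * C + 2 * D) (sub_pos.2 hTse)
  -- the restart time `s₀ < T*` and a solution from `u₀` reaching `b ∈ (s₀, T*)`
  set s₀ : ℝ := max (3 * τ) (max t₀ (Ts - θp / 2)) with hs₀
  have hs₀Ts : s₀ < Ts := max_lt (by linarith) (max_lt ht₀Ts (by linarith))
  have hs₀τ : 3 * τ ≤ s₀ := le_max_left _ _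
  have hs₀t₀ : t₀ ≤ s₀ := (le_max_left _ _).trans (le_max_right _ _)
  have hs₀0 : 0 ≤ s₀ := ht₀0.trans hs₀t₀
  have hTss₀ : Ts < s₀ + θp := by
    have : Ts - θp / 2 ≤ s₀ := (le_max_right _ _).trans (le_max_right _ _)
    linarith
  have hs₀e : s₀ + θp ≤ e := by linarith
  have hs₀mem : s₀ ∈ Icc t₀ e := ⟨hs₀t₀, by linarith⟩
  set b : ℝ := (s₀ + Ts) / 2 with hb
  have hs₀b : s₀ < b := by linarith
  have hbTs : b < Ts := by linarith
  have hb0 : 0 < b := hs₀0.trans_lt hs₀b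
  obtain ⟨-, hbT, u, p, hu, hu0⟩ := hbelow hb0 hbTs
  have humean := hmz hb0 hu hu0
  have hs₀memb : s₀ ∈ Icc 0 b := ⟨hs₀0, hs₀b.le⟩
  -- the restart datum `v₀ = u(s₀) − W(s₀)`
  have hus : Torus.IsSmooth (u s₀) := hu.smooth_velocity.isSmooth_slice hs₀memb
  have hWs : Torus.IsSmooth (W s₀) := hW.smooth_velocity.isSmooth_slice hs₀mem
  have hv₀ : Torus.IsSmooth (fun y => u s₀ y - W s₀ y) := hus.sub hWs
  have hv₀div : Torus.IsDivFree (fun y => u s₀ y - W s₀ y) := fun x => by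
    rw [show (fun y => u s₀ y - W s₀ y) = u s₀ - W s₀ from rfl,
      Torus.divergence_sub (hus.isContDiff (by simp)) (hWs.isContDiff (by simp)), hu.divFree s₀ hs₀memb x,
      hW.divFree s₀ hs₀mem x, sub_zero]
  have hv₀mean : Torus.HasZeroMean (fun y => u s₀ y - W s₀ y) :=
    (humean s₀ hs₀memb).sub (hWmean s₀ hs₀mem) hus.integrable hWs.integrable
  have hMv₀ : ∀ S : Finset (Fin 3 → ℤ), ∑ k ∈ S, (1 + Torus.freqNormSq k) ^ 4 *
      ‖UnitAddTorus.mFourierCoeff (EuclideanSpace.complexify ∘ fun y => u s₀ y - W s₀ y) k‖ ^ 2 ≤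
        2 * C + 2 * D :=
    Torus.sum_one_add_freqNormSq_pow_four_mul_sq_norm_mFourierCoeff_sub_le hus hWs (humean s₀ hs₀memb)
      (hWmean s₀ hs₀mem) (hH4 hb0 hbT hu hu0 s₀ hs₀memb hs₀τ) (hD s₀ hs₀mem)
  obtain ⟨v, q, hv, hq, hvdiv, -, -, hveq, hvs₀⟩ := hrestartP s₀ hs₀mem hs₀e _ hv₀ hv₀div hv₀mean hMv₀
  -- restart: background plus perturbation, glued to the solution from `u₀`
  have hs₀θ : s₀ < s₀ + θp := by linarith
  have hWw : Torus.IsClassicalNSSolutionOn (Icc s₀ (s₀ + θp)) ν f W qW :=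
    hW.mono (Icc_subset_Icc hs₀t₀ hs₀e) (uniqueDiffOn_Icc hs₀θ)
  have h₂ := hWw.add_perturbation hs₀θ hv hq hvdiv hveq
  have h0 : (fun t x => W t x + v t x) s₀ = u s₀ := by
    funext x
    show W s₀ x + v s₀ x = u s₀ x
    rw [hvs₀]
    show W s₀ x + (u s₀ x - W s₀ x) = u s₀ x
    abel
  obtain ⟨u', p', hsol, hleft, -⟩ := hu.glue_restart hν.le h₂ hs₀0 hs₀b (by linarith) h0
  have hu'0 : u' 0 = u₀ := (hleft 0 ⟨le_rfl, hs₀0⟩).trans hu0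
  -- contradiction: a solution from `u₀` strictly past `T*`
  rcases le_or_gt (s₀ + θp) T with hcT | hTc
  · exact habove hTss₀ ⟨hs₀0.trans_lt hs₀θ, hcT, u', p', hsol, hu'0⟩
  · exact hno u' p' ⟨hsol.mono (Icc_subset_Icc le_rfl hTc.le) (uniqueDiffOn_Icc hT), hu'0⟩

end Summit.NavierStokesRegularity.NavierStokesRegularity.Theorems.ForcedAmplifierBlowupAlternativeCore

end
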